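import Summits.QuantumFields.YangMills.Theorems.LuscherReductionTwistedTraceScalingBOMassRatioHodge
import Summits.QuantumFields.YangMills.Theorems.LuscherReductionTwistedTraceScalingBODefectCoreData
import Summits.QuantumFields.YangMills.Theorems.LuscherReductionTwistedTraceScalingBODualProfile
import Summits.QuantumFields.YangMills.Theorems.LuscherReductionTwistedTraceScalingBOCapProfile
import Summits.QuantumFields.YangMills.Theorems.LuscherReductionTwistedTraceScalingBOProjection
import Summits.QuantumFields.YangMills.Theorems.LuscherReductionTwistedTraceScalingRecordBricks
import Summits.QuantumFields.YangMills.Theorems.LuscherReductionTwistedTraceScalingSlowDisintegrationTubes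
import HarnessLib

/-!
# The dual BO function on the shell — GENERAL CAP CONSTANT `Kc`

Support file for the crux `NearFlatRatioLaw` (line `ratepack_v2`, stub `stub_hODpot_A`; successor step (E) of
`Cruxes/NearFlatRatioLaw/Lines/ratepack-v7-moments-g18.md` §14; memo v8 (g19)): lane A's `…BODefectShellB` VERBATIM with the cap constant `43` of
`recordChi L s 43 M β` a parameter `Kc` (the rate twin's stub uses `Kc = 42·max 1 (|Λ|/7) + 1`).
* `shell_boFun_sq_mul_softWeight_le_K`, `shell_boFun_sq_integral_le_K`, ★★ `shell_dualBO_sq_integral_le_K` —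
  `∫ 𝟙_{oTS ∩ {χ≠0} ∩ {R₀<‖x'‖}}·(ψ_φ⊗Ω_c)²·w ≤ N_hi·e^{−β·gap·R₀²}·π(univ)·(Z⁻¹a₀/N̄)²·(linkCE/K₁)²·∫φ²`.
-/

set_option autoImplicit false

noncomputable section

open MeasureTheory Filter Topology Real
open scoped BigOperators RealInnerProductSpace
open Literature.MathematicalPhysics.QuantumFieldTheory
open Literature.MathematicalPhysics.QuantumLattice

namespace Summit.QuantumFields.YangMills.Theorems.FemtoTransferGap.TwoLattice.ConstTube

open Summit.QuantumFields.YangMills.Theorems.FemtoTransferGap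
open Summit.QuantumFields.YangMills.Theorems.FemtoTransferGap.TwoLattice
open Summit.QuantumFields.YangMills.Theorems.FemtoTransferGap.TwoLattice.Avg
open Summit.QuantumFields.YangMills.Theorems.FemtoTransferGap.TwoLattice.Stiff
open Summit.QuantumFields.YangMills.Theorems.FemtoTransferGap.TwoLattice.GnChart

variable {L : ℕ} [NeZero L]

/-! ## §1 ★ The pointwise shell bound -/

/-- ★ **THE DUAL BO FUNCTION IS POINTWISE TINY ON THE SHELL**: at `U ∈ orthoTubeSet` with `recordChi U ≠ 0` and `‖relLinkVec U‖ > R₀ ≥ 0`, for `β ≥ max(1, gap)` and the (P) ceiling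
`N ≤ N_hi` on the fat tube: `(boFun ψ Ω_c U)²·softWeight χ U ≤ N_hi·e^{−β·gap·R₀²}·ψ(slowMean U)²`. [cite: Luscher1983, §3] -/
theorem shell_boFun_sq_mul_softWeight_le_K (hL : 2 ≤ L) {β : ℝ} (hβ : 1 ≤ β) (hβg : 2 - 2 * Real.cos (2 * Real.pi / L) ≤ β) {s Kc M Nhi : ℝ}
    (hP : ∀ U ∈ fatTubeRho L (fun β => Kc * powScale s β) (fun b => M * (Kc * powScale s b)) β, gaugeAvg (recordChi L s Kc M β) U ≤ Nhi)
    (ψ : GaugeConfig 3 1 SU2 → ℝ) {R₀ : ℝ} (hR₀ : 0 ≤ R₀) {U : GaugeConfig 3 L SU2} (hU : U ∈ orthoTubeSet L) (hχ : (recordChi L s Kc M β) U ≠ 0) (hR : R₀ < ‖relLinkVec L U‖) :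
    boFun L ψ (fun x : LinkSpace L => {x : LinkSpace L | linkCurry x ∈ capBalancedSet L}.indicator (fun _ => (1 : ℝ)) x * frozenProfile L (fun β' => stiffGaussExp L (β' / 2) β') (fun β' => min (1 / 40) (powScale (1 / 2) β' * btLog β')) β x) U ^ 2 * softWeight (recordChi L s Kc M β) U ≤ Nhi * Real.exp (-(β * (2 - 2 * Real.cos (2 * Real.pi / L)) * R₀ ^ 2)) * ψ (slowMean L U) ^ 2 := by
  obtain ⟨u, v, hv, rfl⟩ := hU
  have hUF := ((recordChi_props (L := L) s Kc M β).2.2.2 _ hχ).2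
  rw [boFun_orthoTube L ψ _ u hv, slowMean_orthoTube L u hv]
  rw [relLinkVec_orthoTube L u hv] at hR
  have hcap : linkEmbed L v ∈ {x : LinkSpace L | linkCurry x ∈ capBalancedSet L} := (linkEmbed_mem_capLink_iff v).2 hv
  have hΩc : (fun x : LinkSpace L => {x : LinkSpace L | linkCurry x ∈ capBalancedSet L}.indicator (fun _ => (1 : ℝ)) x * frozenProfile L (fun β' => stiffGaussExp L (β' / 2) β') (fun β' => min (1 / 40) (powScale (1 / 2) β' * btLog β')) β x) (linkEmbed L v) = frozenProfile L (fun β' => stiffGaussExp L (β' / 2) β') (fun β' => min (1 / 40) (powScale (1 / 2) β' * btLog β')) β (linkEmbed L v) := by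
    dsimp only; rw [Set.indicator_of_mem hcap, one_mul]
  have hdual := frozenProfile_mul_softWeight_recordChi (L := L) s Kc M β (fun β' => stiffGaussExp L (β' / 2) β') (fun β' => min (1 / 40) (powScale (1 / 2) β' * btLog β')) u hv hUF
  have hN0 : 0 ≤ gaugeAvg (recordChi L s Kc M β) (orthoTube L u v) := by
    obtain ⟨hm, h1, h0, -⟩ := recordChi_props (L := L) s Kc M β
    exact (gaugeAvg_mem_Icc hm (fun V => h0 V) (fun V => (abs_le.mp (h1 V)).2) _).1
  have hNhi := hP _ hUF
  have hq0 : 0 ≤ stiffGaussExp L (β / 2) β (linkEmbed L v) := stiffGaussExp_nonneg _ _ _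
  -- `Ω_c(x) ≤ e^{-‖P_Γx‖²/ε²}·e^{-q(x)}`
  have hfP : frozenProfile L (fun β' => stiffGaussExp L (β' / 2) β') (fun β' => min (1 / 40) (powScale (1 / 2) β' * btLog β')) β (linkEmbed L v) ≤
      Real.exp (-(‖(gaugeModes L).starProjection (linkEmbed L v)‖ ^ 2 / powScale 1 β ^ 2)) * Real.exp (-(stiffGaussExp L (β / 2) β (linkEmbed L v))) := by
    unfold frozenProfile
    have hind : (Metric.closedBall (0 : LinkSpace L) ((fun β' => min (1 / 40) (powScale (1 / 2) β' * btLog β')) β)).indicator (fun _ => (1 : ℝ)) (linkEmbed L v) ≤ 1 := by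
      by_cases h : linkEmbed L v ∈ Metric.closedBall (0 : LinkSpace L) ((fun β' => min (1 / 40) (powScale (1 / 2) β' * btLog β')) β)
      · rw [Set.indicator_of_mem h]
      · rw [Set.indicator_of_notMem h]; exact zero_le_one
    have h2 := mul_le_mul_of_nonneg_left hind (mul_nonneg (Real.exp_pos _).le (Real.exp_pos _).le :
      0 ≤ Real.exp (-(‖(gaugeModes L).starProjection (linkEmbed L v)‖ ^ 2 / powScale 1 β ^ 2)) * Real.exp (-((fun β' => stiffGaussExp L (β' / 2) β') β (linkEmbed L v))))
    rwa [mul_one] at h2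
  have hfP0 : 0 ≤ frozenProfile L (fun β' => stiffGaussExp L (β' / 2) β') (fun β' => min (1 / 40) (powScale (1 / 2) β' * btLog β')) β (linkEmbed L v) := (frozenProfile_mem_Icc (fun β' x => stiffGaussExp_nonneg _ _ x) _ β _).1
  -- the shell Gaussian bound
  have hshell := shell_integrand_le_of_hodge (L := L) hL ker_covCurl_one_le hβ hβg hv.1 hR₀ hR
  -- assemble
  have e : (ψ u * (fun x : LinkSpace L => {x : LinkSpace L | linkCurry x ∈ capBalancedSet L}.indicator (fun _ => (1 : ℝ)) x * frozenProfile L (fun β' => stiffGaussExp L (β' / 2) β') (fun β' => min (1 / 40) (powScale (1 / 2) β' * btLog β')) β x) (linkEmbed L v)) ^ 2 * softWeight (recordChi L s Kc M β) (orthoTube L u v) =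
      ψ u ^ 2 * (frozenProfile L (fun β' => stiffGaussExp L (β' / 2) β') (fun β' => min (1 / 40) (powScale (1 / 2) β' * btLog β')) β (linkEmbed L v) *
        (frozenProfile L (fun β' => stiffGaussExp L (β' / 2) β') (fun β' => min (1 / 40) (powScale (1 / 2) β' * btLog β')) β (linkEmbed L v) * softWeight (recordChi L s Kc M β) (orthoTube L u v))) := by
    rw [hΩc]; ring
  rw [e, hdual]
  have hind1 : (Metric.closedBall (0 : LinkSpace L) ((fun β' => min (1 / 40) (powScale (1 / 2) β' * btLog β')) β)).indicator (fun _ => (1 : ℝ)) (linkEmbed L v) ≤ 1 := by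
    by_cases h : linkEmbed L v ∈ Metric.closedBall (0 : LinkSpace L) ((fun β' => min (1 / 40) (powScale (1 / 2) β' * btLog β')) β)
    · rw [Set.indicator_of_mem h]
    · rw [Set.indicator_of_notMem h]; exact zero_le_one
  have hind0 : 0 ≤ (Metric.closedBall (0 : LinkSpace L) ((fun β' => min (1 / 40) (powScale (1 / 2) β' * btLog β')) β)).indicator (fun _ => (1 : ℝ)) (linkEmbed L v) := Set.indicator_nonneg (fun _ _ => zero_le_one) _
  -- `e^{-q}·𝟙·N ≤ e^{-q}·N_hi`
  have h3 : Real.exp (-((fun β' => stiffGaussExp L (β' / 2) β') β (linkEmbed L v))) * (Metric.closedBall (0 : LinkSpace L) ((fun β' => min (1 / 40) (powScale (1 / 2) β' * btLog β')) β)).indicator (fun _ => (1 : ℝ)) (linkEmbed L v) *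
      gaugeAvg (recordChi L s Kc M β) (orthoTube L u v) ≤ Real.exp (-(stiffGaussExp L (β / 2) β (linkEmbed L v))) * Nhi := by
    calc _ ≤ Real.exp (-((fun β' => stiffGaussExp L (β' / 2) β') β (linkEmbed L v))) * 1 * Nhi :=
          mul_le_mul (mul_le_mul_of_nonneg_left hind1 (Real.exp_pos _).le) hNhi hN0 (mul_nonneg (Real.exp_pos _).le zero_le_one)
      _ = _ := by dsimp only; ring
  have h30 : 0 ≤ Real.exp (-((fun β' => stiffGaussExp L (β' / 2) β') β (linkEmbed L v))) * (Metric.closedBall (0 : LinkSpace L) ((fun β' => min (1 / 40) (powScale (1 / 2) β' * btLog β')) β)).indicator (fun _ => (1 : ℝ)) (linkEmbed L v) *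
      gaugeAvg (recordChi L s Kc M β) (orthoTube L u v) := mul_nonneg (mul_nonneg (Real.exp_pos _).le hind0) hN0
  have hNhi0 : 0 ≤ Nhi := hN0.trans hNhi
  calc ψ u ^ 2 * (frozenProfile L (fun β' => stiffGaussExp L (β' / 2) β') (fun β' => min (1 / 40) (powScale (1 / 2) β' * btLog β')) β (linkEmbed L v) *
        (Real.exp (-((fun β' => stiffGaussExp L (β' / 2) β') β (linkEmbed L v))) * (Metric.closedBall (0 : LinkSpace L) ((fun β' => min (1 / 40) (powScale (1 / 2) β' * btLog β')) β)).indicator (fun _ => (1 : ℝ)) (linkEmbed L v) *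
          gaugeAvg (recordChi L s Kc M β) (orthoTube L u v)))
      ≤ ψ u ^ 2 * ((Real.exp (-(‖(gaugeModes L).starProjection (linkEmbed L v)‖ ^ 2 / powScale 1 β ^ 2)) * Real.exp (-(stiffGaussExp L (β / 2) β (linkEmbed L v)))) *
          (Real.exp (-(stiffGaussExp L (β / 2) β (linkEmbed L v))) * Nhi)) :=
        mul_le_mul_of_nonneg_left (mul_le_mul hfP h3 h30 (by positivity)) (sq_nonneg _)
    _ = ψ u ^ 2 * Nhi * (Real.exp (-(stiffGaussExp L (β / 2) β (linkEmbed L v))) ^ 2 * Real.exp (-(‖(gaugeModes L).starProjection (linkEmbed L v)‖ ^ 2 / powScale 1 β ^ 2))) := by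
        ring
    _ ≤ ψ u ^ 2 * Nhi * Real.exp (-(β * (2 - 2 * Real.cos (2 * Real.pi / L)) * R₀ ^ 2)) := mul_le_mul_of_nonneg_left hshell (mul_nonneg (sq_nonneg _) hNhi0)
    _ = _ := by ring

/-! ## §2 ★★ The integrated shell bound, abstract slow amplitude -/

/-- ★★ **THE DUAL BO FUNCTION ON THE SHELL, INTEGRATED**: for bounded measurable `ψ`, `β ≥ max(1, gap)`, the (P) ceiling `N ≤ N_hi` on the fat tube and `R₀ ≥ 0`,
`∫ 𝟙_{orthoTubeSet ∩ {χ≠0} ∩ {R₀<‖relLinkVec‖}}·(boFun ψ Ω_c)²·w ≤ N_hi·e^{−β·gap·R₀²}·π(univ)·∫ψ²` (`N_hi ≥ 0`). [cite: Luscher1983, §3] -/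
theorem shell_boFun_sq_integral_le_K (hL : 2 ≤ L) {β : ℝ} (hβ : 1 ≤ β) (hβg : 2 - 2 * Real.cos (2 * Real.pi / L) ≤ β) {s Kc M Nhi : ℝ}
    (hP : ∀ U ∈ fatTubeRho L (fun β => Kc * powScale s β) (fun b => M * (Kc * powScale s b)) β, gaugeAvg (recordChi L s Kc M β) U ≤ Nhi) (hNhi : 0 ≤ Nhi)
    {ψ : GaugeConfig 3 1 SU2 → ℝ} (hψm : Measurable ψ) {Cψ : ℝ} (hCψ : ∀ u, |ψ u| ≤ Cψ) {R₀ : ℝ} (hR₀ : 0 ≤ R₀) :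
    ∫ U, (orthoTubeSet L ∩ {U | (recordChi L s Kc M β) U ≠ 0} ∩ {U | R₀ < ‖relLinkVec L U‖}).indicator (fun _ => (1 : ℝ)) U * (boFun L ψ (fun x : LinkSpace L => {x : LinkSpace L | linkCurry x ∈ capBalancedSet L}.indicator (fun _ => (1 : ℝ)) x * frozenProfile L (fun β' => stiffGaussExp L (β' / 2) β') (fun β' => min (1 / 40) (powScale (1 / 2) β' * btLog β')) β x) U ^ 2 * softWeight (recordChi L s Kc M β) U) ∂configMeasure SU2 L ≤
      Nhi * Real.exp (-(β * (2 - 2 * Real.cos (2 * Real.pi / L)) * R₀ ^ 2)) * (orthoTransverse L Set.univ).toReal * ∫ u, ψ u ^ 2 ∂configMeasure SU2 1 := by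
  haveI := isFiniteMeasure_orthoTransverse L
  obtain ⟨hχm, hχ1, hχ0, -⟩ := recordChi_props (L := L) s Kc M β
  obtain ⟨hwm, hwb, hw0, -⟩ := softWeight_recordChi_props (L := L) s Kc M β
  have hqfm : ∀ β', Measurable ((fun β' => stiffGaussExp L (β' / 2) β') β') := fun β' => measurable_stiffGaussExp _ _
  have hqf0 : ∀ β' x, 0 ≤ (fun β' => stiffGaussExp L (β' / 2) β') β' x := fun β' x => stiffGaussExp_nonneg _ _ x
  have hΩGm : Measurable (frozenProfile L (fun β' => stiffGaussExp L (β' / 2) β') (fun β' => min (1 / 40) (powScale (1 / 2) β' * btLog β')) β) := measurable_frozenProfile hqfm _ β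
  have hΩG0 : ∀ x, 0 ≤ frozenProfile L (fun β' => stiffGaussExp L (β' / 2) β') (fun β' => min (1 / 40) (powScale (1 / 2) β' * btLog β')) β x := fun x => (frozenProfile_mem_Icc hqf0 _ β x).1
  have hΩG1 : ∀ x, |frozenProfile L (fun β' => stiffGaussExp L (β' / 2) β') (fun β' => min (1 / 40) (powScale (1 / 2) β' * btLog β')) β x| ≤ 1 := abs_frozenProfile_le hqf0 _ β
  have hΩm := measurable_capRestrict (L := L) hΩGm
  have hΩdat := fun x => capRestrict_mem (L := L) hΩG0 hΩG1 x
  have hS : MeasurableSet (orthoTubeSet L ∩ {U | (recordChi L s Kc M β) U ≠ 0} ∩ {U | R₀ < ‖relLinkVec L U‖}) :=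
    ((measurableSet_orthoTubeSet L).inter ((hχm (measurableSet_singleton 0)).compl)).inter (measurableSet_lt measurable_const (measurable_relLinkVec L).norm)
  set c : ℝ := Nhi * Real.exp (-(β * (2 - 2 * Real.cos (2 * Real.pi / L)) * R₀ ^ 2)) with hcdef
  have hc0 : 0 ≤ c := by rw [hcdef]; exact mul_nonneg hNhi (Real.exp_pos _).le
  set G : GaugeConfig 3 L SU2 → ℝ := fun U => (orthoTubeSet L ∩ {U | (recordChi L s Kc M β) U ≠ 0} ∩ {U | R₀ < ‖relLinkVec L U‖}).indicator (fun _ => (1 : ℝ)) U *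
    (boFun L ψ (fun x : LinkSpace L => {x : LinkSpace L | linkCurry x ∈ capBalancedSet L}.indicator (fun _ => (1 : ℝ)) x * frozenProfile L (fun β' => stiffGaussExp L (β' / 2) β') (fun β' => min (1 / 40) (powScale (1 / 2) β' * btLog β')) β x) U ^ 2 * softWeight (recordChi L s Kc M β) U) with hGdef
  set H : GaugeConfig 3 L SU2 → ℝ := fun U => (orthoTubeSet L).indicator (fun _ => (1 : ℝ)) U * (c * ψ (slowMean L U) ^ 2) with hHdef
  have hbm : Measurable (boFun L ψ (fun x : LinkSpace L => {x : LinkSpace L | linkCurry x ∈ capBalancedSet L}.indicator (fun _ => (1 : ℝ)) x * frozenProfile L (fun β' => stiffGaussExp L (β' / 2) β') (fun β' => min (1 / 40) (powScale (1 / 2) β' * btLog β')) β x)) := measurable_boFun L hψm hΩm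
  have hbb : ∀ U, |boFun L ψ (fun x : LinkSpace L => {x : LinkSpace L | linkCurry x ∈ capBalancedSet L}.indicator (fun _ => (1 : ℝ)) x * frozenProfile L (fun β' => stiffGaussExp L (β' / 2) β') (fun β' => min (1 / 40) (powScale (1 / 2) β' * btLog β')) β x) U| ≤ Cψ * 1 := fun U => abs_boFun_le L hCψ (fun x => (hΩdat x).2.2) U
  have hGi : Integrable G (configMeasure SU2 L) := by
    rw [hGdef]
    refine integrable_of_measurable_abs_le _ ((measurable_const.indicator hS).mul ((hbm.pow_const 2).mul hwm))
      (C := (Cψ * 1) ^ 2 * Real.exp ((Fintype.card (Edge 3 L) : ℝ) / powScale 1 β ^ 2)) fun U => ?_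
    have hin : |(orthoTubeSet L ∩ {U | (recordChi L s Kc M β) U ≠ 0} ∩ {U | R₀ < ‖relLinkVec L U‖}).indicator (fun _ => (1 : ℝ)) U| ≤ 1 := by
      by_cases h : U ∈ orthoTubeSet L ∩ {U | (recordChi L s Kc M β) U ≠ 0} ∩ {U | R₀ < ‖relLinkVec L U‖}
      · rw [Set.indicator_of_mem h, abs_one]
      · rw [Set.indicator_of_notMem h, abs_zero]; exact zero_le_one
    rw [abs_mul, abs_mul, abs_pow, abs_of_nonneg (hw0 U)]
    calc _ ≤ 1 * ((Cψ * 1) ^ 2 * Real.exp ((Fintype.card (Edge 3 L) : ℝ) / powScale 1 β ^ 2)) :=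
          mul_le_mul hin (mul_le_mul (pow_le_pow_left₀ (abs_nonneg _) (hbb U) 2) ((le_abs_self _).trans (hwb U)) (hw0 U) (sq_nonneg _))
            (mul_nonneg (sq_nonneg _) (hw0 U)) zero_le_one
      _ = _ := one_mul _
  have hHm : Measurable H := by
    rw [hHdef]
    exact (measurable_const.indicator (measurableSet_orthoTubeSet L)).mul (measurable_const.mul ((hψm.comp (measurable_slowMean L)).pow_const 2))
  have hHb : ∀ U, |H U| ≤ c * Cψ ^ 2 := fun U => by
    rw [hHdef]; dsimp only
    have hin : (orthoTubeSet L).indicator (fun _ => (1 : ℝ)) U ≤ 1 := by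
      by_cases h : U ∈ orthoTubeSet L
      · rw [Set.indicator_of_mem h]
      · rw [Set.indicator_of_notMem h]; exact zero_le_one
    have hin0 : 0 ≤ (orthoTubeSet L).indicator (fun _ => (1 : ℝ)) U := Set.indicator_nonneg (fun _ _ => zero_le_one) _
    rw [abs_mul, abs_of_nonneg hin0, abs_mul, abs_of_nonneg hc0, abs_pow]
    calc _ ≤ 1 * (c * Cψ ^ 2) := mul_le_mul hin (mul_le_mul_of_nonneg_left (pow_le_pow_left₀ (abs_nonneg _) (hCψ _) 2) hc0) (by positivity) zero_le_one
      _ = _ := one_mul _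
  have hHi : Integrable H (configMeasure SU2 L) := integrable_of_measurable_abs_le _ hHm hHb
  have hGH : ∀ U, G U ≤ H U := fun U => by
    rw [hGdef, hHdef]; dsimp only
    by_cases hU : U ∈ orthoTubeSet L ∩ {U | (recordChi L s Kc M β) U ≠ 0} ∩ {U | R₀ < ‖relLinkVec L U‖}
    · have hU' := hU
      obtain ⟨⟨hU1, hU2⟩, hU3⟩ := hU'
      rw [Set.indicator_of_mem hU, Set.indicator_of_mem hU1, one_mul, one_mul]
      exact shell_boFun_sq_mul_softWeight_le_K (L := L) hL hβ hβg hP ψ hR₀ hU1 hU2 hU3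
    · rw [Set.indicator_of_notMem hU, zero_mul]
      exact mul_nonneg (Set.indicator_nonneg (fun _ _ => zero_le_one) _) (mul_nonneg hc0 (sq_nonneg _))
  have hH0 : ∀ U, U ∉ orthoTubeSet L → H U = 0 := fun U hU => by rw [hHdef]; dsimp only; rw [Set.indicator_of_notMem hU, zero_mul]
  have hHslow : ∀ (u : GaugeConfig 3 1 SU2) (v : Edge 3 L → Fin 3 → ℝ), v ∈ capBalancedSet L → H (orthoTube L u v) = c * ψ u ^ 2 := fun u v hv => by
    rw [hHdef]; dsimp only; rw [Set.indicator_of_mem (orthoTube_mem L u hv), one_mul, slowMean_orthoTube L u hv]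
  have hIH := integral_configMeasure_orthoTube_of_slow L hHm ⟨c * Cψ ^ 2, hHb⟩ hH0 hHslow
  calc ∫ U, G U ∂configMeasure SU2 L ≤ ∫ U, H U ∂configMeasure SU2 L := integral_mono hGi hHi hGH
    _ = (orthoTransverse L Set.univ).toReal * ∫ u, c * ψ u ^ 2 ∂configMeasure SU2 1 := hIH
    _ = _ := by rw [integral_const_mul, hcdef]; ring


/-! ## §3 ★★ The record dual amplitude -/

/-- ★★ **THE RECORD DUAL BO FUNCTION ON THE SHELL**: for the dual slow amplitude `ψ_φ(u') = Z⁻¹·a₀/N̄·∫φ(u)ρ̃(u',u)du` (`ρ̃ = K̃₁/K₁(1,1)`, `a₀` free) of a bounded measurable `φ`,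
`β ≥ max(1, gap)`, the (P) ceiling `N ≤ N_hi` (`N_hi ≥ 0`) and `R₀ ≥ 0`:
`∫ 𝟙_{orthoTubeSet ∩ {χ≠0} ∩ {R₀<‖relLinkVec‖}}·(ψ_φ⊗Ω_c)²·w ≤ N_hi·e^{−β·gap·R₀²}·π(univ)·((Z⁻¹a₀/N̄)²·(linkCE(L³β)/K₁(1,1))²·∫φ²)`. [cite: Luscher1983, §3] -/
theorem shell_dualBO_sq_integral_le_K (hL : 2 ≤ L) {β : ℝ} (hβ : 1 ≤ β) (hβg : 2 - 2 * Real.cos (2 * Real.pi / L) ≤ β) {s Kc M Nhi : ℝ}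
    (hP : ∀ U ∈ fatTubeRho L (fun β => Kc * powScale s β) (fun b => M * (Kc * powScale s b)) β, gaugeAvg (recordChi L s Kc M β) U ≤ Nhi) (hNhi : 0 ≤ Nhi)
    {φ : GaugeConfig 3 1 SU2 → ℝ} (hφm : Measurable φ) {Cφ : ℝ} (hCφ : ∀ u, |φ u| ≤ Cφ) (a₀ : ℝ) {R₀ : ℝ} (hR₀ : 0 ≤ R₀) :
    ∫ U, (orthoTubeSet L ∩ {U | (recordChi L s Kc M β) U ≠ 0} ∩ {U | R₀ < ‖relLinkVec L U‖}).indicator (fun _ => (1 : ℝ)) U *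
        (boFun L (fun u' => (fpZ (powScale 1 β))⁻¹ * a₀ / (fpWeightBar L (powScale 1 β)) * (∫ u, φ u * (avgKernel ((L : ℝ) ^ 3 * β) u' u / transferKernel su2Rep ((L : ℝ) ^ 3 * β) (1 : GaugeConfig 3 1 SU2) 1) ∂configMeasure SU2 1)) (fun x : LinkSpace L => {x : LinkSpace L | linkCurry x ∈ capBalancedSet L}.indicator (fun _ => (1 : ℝ)) x * frozenProfile L (fun β' => stiffGaussExp L (β' / 2) β') (fun β' => min (1 / 40) (powScale (1 / 2) β' * btLog β')) β x) U ^ 2 * softWeight (recordChi L s Kc M β) U) ∂configMeasure SU2 L ≤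
      Nhi * Real.exp (-(β * (2 - 2 * Real.cos (2 * Real.pi / L)) * R₀ ^ 2)) * (orthoTransverse L Set.univ).toReal *
        (((fpZ (powScale 1 β))⁻¹ * a₀ / (fpWeightBar L (powScale 1 β))) ^ 2 * ((linkCE ((L : ℝ) ^ 3 * β) / transferKernel su2Rep ((L : ℝ) ^ 3 * β) (1 : GaugeConfig 3 1 SU2) 1) ^ 2 * ∫ u, φ u ^ 2 ∂configMeasure SU2 1)) := by
  have hβ0 : 0 < β := by linarith
  have hB : (0 : ℝ) ≤ (L : ℝ) ^ 3 * β := by positivity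
  have hK1 : 0 < transferKernel su2Rep ((L : ℝ) ^ 3 * β) (1 : GaugeConfig 3 1 SU2) 1 := transferKernel_pos _ _ _ _
  have hPm := measurable_slowP ((L : ℝ) ^ 3 * β) (transferKernel su2Rep ((L : ℝ) ^ 3 * β) (1 : GaugeConfig 3 1 SU2) 1) hφm
  have hPam := measurable_slowP ((L : ℝ) ^ 3 * β) (transferKernel su2Rep ((L : ℝ) ^ 3 * β) (1 : GaugeConfig 3 1 SU2) 1) hφm.abs
  obtain ⟨M1, -, hM1⟩ := exists_avgKernel_le (L := 1) ((L : ℝ) ^ 3 * β)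
  have hPb : ∀ u', |∫ u, φ u * (avgKernel ((L : ℝ) ^ 3 * β) u' u / transferKernel su2Rep ((L : ℝ) ^ 3 * β) (1 : GaugeConfig 3 1 SU2) 1) ∂configMeasure SU2 1| ≤ Cφ * (M1 / transferKernel su2Rep ((L : ℝ) ^ 3 * β) (1 : GaugeConfig 3 1 SU2) 1) :=
    fun u' => abs_slowP_le hK1 hCφ (fun u'' u => hM1 u'' u) u'
  have hPab : ∀ u', |∫ u, |φ u| * (avgKernel ((L : ℝ) ^ 3 * β) u' u / transferKernel su2Rep ((L : ℝ) ^ 3 * β) (1 : GaugeConfig 3 1 SU2) 1) ∂configMeasure SU2 1| ≤ Cφ * (M1 / transferKernel su2Rep ((L : ℝ) ^ 3 * β) (1 : GaugeConfig 3 1 SU2) 1) :=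
    fun u' => abs_slowP_le hK1 (h := fun u => |φ u|) (fun u => by rw [abs_abs]; exact hCφ u) (fun u'' u => hM1 u'' u) u'
  set C : ℝ := (fpZ (powScale 1 β))⁻¹ * a₀ / (fpWeightBar L (powScale 1 β)) with hCdef
  have hψm : Measurable (fun u' => (fpZ (powScale 1 β))⁻¹ * a₀ / (fpWeightBar L (powScale 1 β)) * (∫ u, φ u * (avgKernel ((L : ℝ) ^ 3 * β) u' u / transferKernel su2Rep ((L : ℝ) ^ 3 * β) (1 : GaugeConfig 3 1 SU2) 1) ∂configMeasure SU2 1)) :=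
    hPm.const_mul _
  have hψb : ∀ u', |(fpZ (powScale 1 β))⁻¹ * a₀ / (fpWeightBar L (powScale 1 β)) * (∫ u, φ u * (avgKernel ((L : ℝ) ^ 3 * β) u' u / transferKernel su2Rep ((L : ℝ) ^ 3 * β) (1 : GaugeConfig 3 1 SU2) 1) ∂configMeasure SU2 1)| ≤ |C| * (Cφ * (M1 / transferKernel su2Rep ((L : ℝ) ^ 3 * β) (1 : GaugeConfig 3 1 SU2) 1)) :=
    fun u' => by rw [abs_mul]; exact mul_le_mul_of_nonneg_left (hPb u') (abs_nonneg _)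
  have h := shell_boFun_sq_integral_le_K (L := L) hL hβ hβg hP hNhi hψm hψb hR₀
  refine h.trans (mul_le_mul_of_nonneg_left ?_ (mul_nonneg (mul_nonneg hNhi (Real.exp_pos _).le) ENNReal.toReal_nonneg))
  -- `∫ ψ² = C²·∫P² ≤ C²·∫P_a² ≤ C²·(Λ₁/K₁)²·∫φ²`
  have e1 : ∫ u', ((fpZ (powScale 1 β))⁻¹ * a₀ / (fpWeightBar L (powScale 1 β)) * (∫ u, φ u * (avgKernel ((L : ℝ) ^ 3 * β) u' u / transferKernel su2Rep ((L : ℝ) ^ 3 * β) (1 : GaugeConfig 3 1 SU2) 1) ∂configMeasure SU2 1)) ^ 2 ∂configMeasure SU2 1 =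
      C ^ 2 * ∫ u', (∫ u, φ u * (avgKernel ((L : ℝ) ^ 3 * β) u' u / transferKernel su2Rep ((L : ℝ) ^ 3 * β) (1 : GaugeConfig 3 1 SU2) 1) ∂configMeasure SU2 1) ^ 2 ∂configMeasure SU2 1 := by
    rw [← integral_const_mul]
    refine integral_congr_ae (ae_of_all _ fun u' => ?_)
    dsimp only; rw [hCdef]; ring
  rw [e1]
  refine mul_le_mul_of_nonneg_left ?_ (sq_nonneg _)
  have iP : Integrable (fun u' => (∫ u, φ u * (avgKernel ((L : ℝ) ^ 3 * β) u' u / transferKernel su2Rep ((L : ℝ) ^ 3 * β) (1 : GaugeConfig 3 1 SU2) 1) ∂configMeasure SU2 1) ^ 2) (configMeasure SU2 1) :=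
    integrable_of_measurable_abs_le _ (hPm.pow_const 2) (C := (Cφ * (M1 / transferKernel su2Rep ((L : ℝ) ^ 3 * β) (1 : GaugeConfig 3 1 SU2) 1)) ^ 2) fun u' => by
      rw [abs_pow]; exact pow_le_pow_left₀ (abs_nonneg _) (hPb u') 2
  have iPa : Integrable (fun u' => (∫ u, |φ u| * (avgKernel ((L : ℝ) ^ 3 * β) u' u / transferKernel su2Rep ((L : ℝ) ^ 3 * β) (1 : GaugeConfig 3 1 SU2) 1) ∂configMeasure SU2 1) ^ 2) (configMeasure SU2 1) :=
    integrable_of_measurable_abs_le _ (hPam.pow_const 2) (C := (Cφ * (M1 / transferKernel su2Rep ((L : ℝ) ^ 3 * β) (1 : GaugeConfig 3 1 SU2) 1)) ^ 2) fun u' => by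
      rw [abs_pow]; exact pow_le_pow_left₀ (abs_nonneg _) (hPab u') 2
  calc ∫ u', (∫ u, φ u * (avgKernel ((L : ℝ) ^ 3 * β) u' u / transferKernel su2Rep ((L : ℝ) ^ 3 * β) (1 : GaugeConfig 3 1 SU2) 1) ∂configMeasure SU2 1) ^ 2 ∂configMeasure SU2 1
      ≤ ∫ u', (∫ u, |φ u| * (avgKernel ((L : ℝ) ^ 3 * β) u' u / transferKernel su2Rep ((L : ℝ) ^ 3 * β) (1 : GaugeConfig 3 1 SU2) 1) ∂configMeasure SU2 1) ^ 2 ∂configMeasure SU2 1 := by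
        refine integral_mono iP iPa fun u' => ?_
        dsimp only
        rw [← sq_abs (∫ u, φ u * (avgKernel ((L : ℝ) ^ 3 * β) u' u / transferKernel su2Rep ((L : ℝ) ^ 3 * β) (1 : GaugeConfig 3 1 SU2) 1) ∂configMeasure SU2 1)]
        exact pow_le_pow_left₀ (abs_nonneg _) (abs_slowP_le_slowPa hK1 u') 2
    _ ≤ (linkCE ((L : ℝ) ^ 3 * β) / transferKernel su2Rep ((L : ℝ) ^ 3 * β) (1 : GaugeConfig 3 1 SU2) 1) ^ 2 * ∫ u, φ u ^ 2 ∂configMeasure SU2 1 := sq_integral_slowPa_le hB hK1 hφm hCφ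

end Summit.QuantumFields.YangMills.Theorems.FemtoTransferGap.TwoLattice.ConstTube

end
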